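import Summits.CriticalPhenomena.PercolationContinuityZ3.Theorems.PercNearOneGluingNoHeavyLowerTailKnQuestion8CoefficientwiseFlipHarris
import HarnessLib

/-!
# Root-edge anatomy I–II on any multigraph: `H ≥ S′_{D1}` and `2H ≥ NO-CORE + 2·S_{D2}` — prim-lf-2 gen 53 (part 6a)

Support file (`--supports stmt-CriticalPhenomena-4575`, closed), prover `prim-lf-2` (gen 53).  No definitions, no named facts, no sorries; standard axioms.
Memo `prim-lf-2/CW-SERIES-gen53.md` §7.4–7.6.  Parts 3 and 5: `…CoefficientwiseRootEdgePoint.lean` (`NO-CORE^G = 2·Σ_{u ∉ K̄, br}(g(K∪U) − g(K̄))` on `G − e`),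
`…CoefficientwiseFlipHarris.lean` (LEMMA S′).

Setting.  Finite multigraph `ends : ι → Sym2 V`, root `x`, `K(t) = C_x(t)`, `K̄(t) = K(tᶜ)`, `U(t) = C_u(t)`, `Ū(t) = U(tᶜ)`, `br(t) := ¬(y ∈ K t ∪ U t ∧ y ∈ K̄ t)`;
`H := Σ_{t : br, u ∉ K̄} (g(K ∪ U) − g(K̄))` (part 3: `NO-CORE^G(y)[1_u,g] = 2·H` computed on `G − e` for a root edge `e = xu`).  On ANY multigraph, for all `u, y`, monotone `g`:
* `rootEdge_half_ge_sprimeD1` — `H ≥ S′_{D1} := Σ_{t : u ∈ K̄ ∖ K, ¬(y ∈ K̄ ∧ y ∈ K ∪ U)} (g(K̄) − g(K))`;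
* `rootEdge_half_ge_halfNoCore_add_sD2` — `2·H ≥ NO-CORE(y)[1_u,g] + 2·S_{D2}`, `S_{D2} := Σ_{t : u walled, y ∈ U ∩ K̄} (g(K̄ ∪ Ū) − g(K))` (NO-CORE of the SAME graph).
Proof (memo §7.4): split `u ∉ K̄` into `u ∈ K ∖ K̄` and `u` walled.  The inner part is `½·NO-CORE(y)[1_u,g]` (the core-of-`u` colourings cancel under the swap) and also, after the
swap, `S′_{D1} + X`, `X = Σ_{u ∈ K̄∖K, y ∈ U ∩ K̄}(g(K̄) − g(K))`; the walled part is, after swapping its blue term and dropping the termwise-nonnegative kind `T₁₁`, at least `S_{D2}`;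
and `S_{D2} + X` is exactly LEMMA S′'s sum (part 5, `≥ 0`) — the `X`'s cancel.
The corollaries for a root edge `e = xu` on `G − e` (`NO-CORE^G ≥ 2·S′_{D1}`; `S′_{D1} ≥ 0 ⇒` NO-CORE at `u`; `NO-CORE^{G−e} + 2·S_{D2} ≤ NO-CORE^G`; `S_{D2} ≥ 0 ⇒` root-edge
monotonicity) are part 6b (`…CoefficientwiseRootEdgeMonotone.lean`, with part 3's root-edge identity).
`S′_{D1} ≥ 0` (without the `y`-bracket it is gen 29's one-sided domination) is WEAKER than CLAIM B of part 3 (`−V = S′_{D1} − T_B`, `T_B ≥ 0` termwise, memo §7.6); `S′_{D1} ≥ 0` and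
`S_{D2} ≥ 0` are census-clean on every graph with ≤ 7 vertices (all `u ~ x`, `y`, min over all monotone `g`; prim-lf-2 kit j211265/267/269, columns D1, D2) and neither is positive
cell-by-cell (768 resp. 24 of ≈ 36 000 red-cluster cells of `u` at `n = 5`): these are the remaining atoms at root-adjacent points (NO-CORE resp. root-edge monotonicity).
[cite: KozmaNitzan2024, Questions 8–9 (§5.5 p. 36) (context: the Question-8 pocket covariance programme)]
-/

namespace Summit.CriticalPhenomena.PercolationContinuityZ3.Theorems

open Finset Literature.Probability.Percolation

namespace Coefficientwise

variable {ι V : Type*} [Fintype ι] [DecidableEq ι] (ends : ι → Sym2 V) (x : V)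

section anatomy
variable (u y : V) (g : Set V → ℝ)


omit [Fintype ι] [DecidableEq ι] in
/-- `u ∈ K(t)` forces `U(t) = K(t)`. [cite: KozmaNitzan2024, §5.5 (context only; folklore)] -/
private theorem clusterU_eq_of_mem (t : Finset ι) (hu : u ∈ (openCluster (ends '' (↑(t) : Set ι)) x)) : (openCluster (ends '' (↑(t) : Set ι)) u) = (openCluster (ends '' (↑(t) : Set ι)) x) := by
  ext v
  exact ⟨fun hv => SimpleGraph.Reachable.trans hu hv, fun hv => SimpleGraph.Reachable.trans (SimpleGraph.Reachable.symm hu) hv⟩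

omit [Fintype ι] [DecidableEq ι] in
/-- if `u ∉ K(t)` and `y ∈ U(t)` then `y ∉ K(t)`. [cite: KozmaNitzan2024, §5.5 (context only; folklore)] -/
private theorem not_mem_K_of_mem_U (t : Finset ι) (hu : u ∉ (openCluster (ends '' (↑(t) : Set ι)) x)) (hy : y ∈ (openCluster (ends '' (↑(t) : Set ι)) u)) : y ∉ (openCluster (ends '' (↑(t) : Set ι)) x) :=
  fun hyK => hu (SimpleGraph.Reachable.trans hyK (SimpleGraph.Reachable.symm hy))

open Classical in
/-- Split of the half no-core sum at `u ∈ K`: `H = (inner part) + (walled part)`. [cite: KozmaNitzan2024, §5.5 (context only; bookkeeping)] -/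
private theorem half_split :
    ∑ t ∈ univ.filter (fun t : Finset ι => ¬ (y ∈ (openCluster (ends '' (↑(t) : Set ι)) x) ∪ (openCluster (ends '' (↑(t) : Set ι)) u) ∧ y ∈ (openCluster (ends '' (↑(tᶜ) : Set ι)) x)) ∧ u ∉ (openCluster (ends '' (↑(tᶜ) : Set ι)) x)), (g ((openCluster (ends '' (↑(t) : Set ι)) x) ∪ (openCluster (ends '' (↑(t) : Set ι)) u)) - g (openCluster (ends '' (↑(tᶜ) : Set ι)) x)) =
      ∑ t : Finset ι, (if ((¬ (y ∈ (openCluster (ends '' (↑(t) : Set ι)) x) ∪ (openCluster (ends '' (↑(t) : Set ι)) u) ∧ y ∈ (openCluster (ends '' (↑(tᶜ) : Set ι)) x)) ∧ u ∉ (openCluster (ends '' (↑(tᶜ) : Set ι)) x)) ∧ u ∈ (openCluster (ends '' (↑(t) : Set ι)) x)) then (g ((openCluster (ends '' (↑(t) : Set ι)) x) ∪ (openCluster (ends '' (↑(t) : Set ι)) u)) - g (openCluster (ends '' (↑(tᶜ) : Set ι)) x)) else 0) +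
      ∑ t : Finset ι, (if ((¬ (y ∈ (openCluster (ends '' (↑(t) : Set ι)) x) ∪ (openCluster (ends '' (↑(t) : Set ι)) u) ∧ y ∈ (openCluster (ends '' (↑(tᶜ) : Set ι)) x)) ∧ u ∉ (openCluster (ends '' (↑(tᶜ) : Set ι)) x)) ∧ u ∉ (openCluster (ends '' (↑(t) : Set ι)) x)) then (g ((openCluster (ends '' (↑(t) : Set ι)) x) ∪ (openCluster (ends '' (↑(t) : Set ι)) u)) - g (openCluster (ends '' (↑(tᶜ) : Set ι)) x)) else 0) := by
  rw [Finset.sum_filter, ← Finset.sum_add_distrib]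
  refine Finset.sum_congr rfl fun t _ => ?_
  by_cases h : (¬ (y ∈ (openCluster (ends '' (↑(t) : Set ι)) x) ∪ (openCluster (ends '' (↑(t) : Set ι)) u) ∧ y ∈ (openCluster (ends '' (↑(tᶜ) : Set ι)) x)) ∧ u ∉ (openCluster (ends '' (↑(tᶜ) : Set ι)) x))
  · by_cases hu : u ∈ (openCluster (ends '' (↑(t) : Set ι)) x)
    · have : ¬ ((¬ (y ∈ (openCluster (ends '' (↑(t) : Set ι)) x) ∪ (openCluster (ends '' (↑(t) : Set ι)) u) ∧ y ∈ (openCluster (ends '' (↑(tᶜ) : Set ι)) x)) ∧ u ∉ (openCluster (ends '' (↑(tᶜ) : Set ι)) x)) ∧ u ∉ (openCluster (ends '' (↑(t) : Set ι)) x)) := fun h' => h'.2 hu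
      rw [if_pos h, if_pos ⟨h, hu⟩, if_neg this, add_zero]
    · have : ¬ ((¬ (y ∈ (openCluster (ends '' (↑(t) : Set ι)) x) ∪ (openCluster (ends '' (↑(t) : Set ι)) u) ∧ y ∈ (openCluster (ends '' (↑(tᶜ) : Set ι)) x)) ∧ u ∉ (openCluster (ends '' (↑(tᶜ) : Set ι)) x)) ∧ u ∈ (openCluster (ends '' (↑(t) : Set ι)) x)) := fun h' => hu h'.2
      rw [if_pos h, if_neg this, if_pos ⟨h, hu⟩, zero_add]
  · have h3 : ¬ ((¬ (y ∈ (openCluster (ends '' (↑(t) : Set ι)) x) ∪ (openCluster (ends '' (↑(t) : Set ι)) u) ∧ y ∈ (openCluster (ends '' (↑(tᶜ) : Set ι)) x)) ∧ u ∉ (openCluster (ends '' (↑(tᶜ) : Set ι)) x)) ∧ u ∈ (openCluster (ends '' (↑(t) : Set ι)) x)) := fun h' => h h'.1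
    have h4 : ¬ ((¬ (y ∈ (openCluster (ends '' (↑(t) : Set ι)) x) ∪ (openCluster (ends '' (↑(t) : Set ι)) u) ∧ y ∈ (openCluster (ends '' (↑(tᶜ) : Set ι)) x)) ∧ u ∉ (openCluster (ends '' (↑(tᶜ) : Set ι)) x)) ∧ u ∉ (openCluster (ends '' (↑(t) : Set ι)) x)) := fun h' => h h'.1
    rw [if_neg h, if_neg h3, if_neg h4, add_zero]

open Classical in
/-- The inner part after the colour swap: `S′_{D1} + X`. [cite: KozmaNitzan2024, §5.5 (context only; bookkeeping)] -/
private theorem inner_swap_eq :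
    ∑ t : Finset ι, (if ((¬ (y ∈ (openCluster (ends '' (↑(t) : Set ι)) x) ∪ (openCluster (ends '' (↑(t) : Set ι)) u) ∧ y ∈ (openCluster (ends '' (↑(tᶜ) : Set ι)) x)) ∧ u ∉ (openCluster (ends '' (↑(tᶜ) : Set ι)) x)) ∧ u ∈ (openCluster (ends '' (↑(t) : Set ι)) x)) then (g ((openCluster (ends '' (↑(t) : Set ι)) x) ∪ (openCluster (ends '' (↑(t) : Set ι)) u)) - g (openCluster (ends '' (↑(tᶜ) : Set ι)) x)) else 0) =
      ∑ t : Finset ι, ((if ((u ∈ (openCluster (ends '' (↑(tᶜ) : Set ι)) x) ∧ u ∉ (openCluster (ends '' (↑(t) : Set ι)) x)) ∧ ¬ (y ∈ (openCluster (ends '' (↑(tᶜ) : Set ι)) x) ∧ y ∈ (openCluster (ends '' (↑(t) : Set ι)) x) ∪ (openCluster (ends '' (↑(t) : Set ι)) u))) then (g (openCluster (ends '' (↑(tᶜ) : Set ι)) x) - g (openCluster (ends '' (↑(t) : Set ι)) x)) else 0) +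
        (if ((u ∈ (openCluster (ends '' (↑(tᶜ) : Set ι)) x) ∧ u ∉ (openCluster (ends '' (↑(t) : Set ι)) x)) ∧ (y ∈ (openCluster (ends '' (↑(tᶜ) : Set ι)) x) ∧ y ∈ (openCluster (ends '' (↑(t) : Set ι)) u))) then (g (openCluster (ends '' (↑(tᶜ) : Set ι)) x) - g (openCluster (ends '' (↑(t) : Set ι)) x)) else 0)) := by
  rw [← sum_compl_eq (fun t : Finset ι => (if ((¬ (y ∈ (openCluster (ends '' (↑(t) : Set ι)) x) ∪ (openCluster (ends '' (↑(t) : Set ι)) u) ∧ y ∈ (openCluster (ends '' (↑(tᶜ) : Set ι)) x)) ∧ u ∉ (openCluster (ends '' (↑(tᶜ) : Set ι)) x)) ∧ u ∈ (openCluster (ends '' (↑(t) : Set ι)) x)) then (g ((openCluster (ends '' (↑(t) : Set ι)) x) ∪ (openCluster (ends '' (↑(t) : Set ι)) u)) - g (openCluster (ends '' (↑(tᶜ) : Set ι)) x)) else 0))]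
  refine Finset.sum_congr rfl fun t _ => ?_
  simp only [compl_compl]
  by_cases hu : (u ∈ (openCluster (ends '' (↑(tᶜ) : Set ι)) x) ∧ u ∉ (openCluster (ends '' (↑(t) : Set ι)) x))
  · have hUe : (openCluster (ends '' (↑(tᶜ) : Set ι)) u) = (openCluster (ends '' (↑(tᶜ) : Set ι)) x) := clusterU_eq_of_mem ends x u tᶜ hu.1
    by_cases h1 : ¬ (y ∈ (openCluster (ends '' (↑(tᶜ) : Set ι)) x) ∧ y ∈ (openCluster (ends '' (↑(t) : Set ι)) x) ∪ (openCluster (ends '' (↑(t) : Set ι)) u))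
    · have hfire : (¬ (y ∈ (openCluster (ends '' (↑(tᶜ) : Set ι)) x) ∪ (openCluster (ends '' (↑(tᶜ) : Set ι)) u) ∧ y ∈ (openCluster (ends '' (↑(t) : Set ι)) x)) ∧ u ∉ (openCluster (ends '' (↑(t) : Set ι)) x)) ∧ u ∈ (openCluster (ends '' (↑(tᶜ) : Set ι)) x) := by
        refine ⟨⟨?_, hu.2⟩, hu.1⟩
        rw [hUe, Set.union_self]
        exact fun h' => h1 ⟨h'.1, Or.inl h'.2⟩
      have hnX : ¬ ((u ∈ (openCluster (ends '' (↑(tᶜ) : Set ι)) x) ∧ u ∉ (openCluster (ends '' (↑(t) : Set ι)) x)) ∧ (y ∈ (openCluster (ends '' (↑(tᶜ) : Set ι)) x) ∧ y ∈ (openCluster (ends '' (↑(t) : Set ι)) u))) := fun h' => h1 ⟨h'.2.1, Or.inr h'.2.2⟩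
      rw [if_pos hfire, if_pos ⟨hu, h1⟩, if_neg hnX, hUe, Set.union_self, add_zero]
    · have h1' : y ∈ (openCluster (ends '' (↑(tᶜ) : Set ι)) x) ∧ y ∈ (openCluster (ends '' (↑(t) : Set ι)) x) ∪ (openCluster (ends '' (↑(t) : Set ι)) u) := not_not.mp h1
      have hyKb : y ∈ (openCluster (ends '' (↑(tᶜ) : Set ι)) x) := h1'.1
      rcases h1'.2 with hyK | hyUt
      · have hnf : ¬ ((¬ (y ∈ (openCluster (ends '' (↑(tᶜ) : Set ι)) x) ∪ (openCluster (ends '' (↑(tᶜ) : Set ι)) u) ∧ y ∈ (openCluster (ends '' (↑(t) : Set ι)) x)) ∧ u ∉ (openCluster (ends '' (↑(t) : Set ι)) x)) ∧ u ∈ (openCluster (ends '' (↑(tᶜ) : Set ι)) x)) := fun h' => h'.1.1 ⟨Or.inl hyKb, hyK⟩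
        have hn1 : ¬ ((u ∈ (openCluster (ends '' (↑(tᶜ) : Set ι)) x) ∧ u ∉ (openCluster (ends '' (↑(t) : Set ι)) x)) ∧ ¬ (y ∈ (openCluster (ends '' (↑(tᶜ) : Set ι)) x) ∧ y ∈ (openCluster (ends '' (↑(t) : Set ι)) x) ∪ (openCluster (ends '' (↑(t) : Set ι)) u))) := fun h' => h'.2 ⟨hyKb, Or.inl hyK⟩
        have hnX : ¬ ((u ∈ (openCluster (ends '' (↑(tᶜ) : Set ι)) x) ∧ u ∉ (openCluster (ends '' (↑(t) : Set ι)) x)) ∧ (y ∈ (openCluster (ends '' (↑(tᶜ) : Set ι)) x) ∧ y ∈ (openCluster (ends '' (↑(t) : Set ι)) u))) :=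
          fun h' => (not_mem_K_of_mem_U ends x u y t hu.2 h'.2.2) hyK
        rw [if_neg hnf, if_neg hn1, if_neg hnX, add_zero]
      · have hyK : y ∉ (openCluster (ends '' (↑(t) : Set ι)) x) := not_mem_K_of_mem_U ends x u y t hu.2 hyUt
        have hfire : (¬ (y ∈ (openCluster (ends '' (↑(tᶜ) : Set ι)) x) ∪ (openCluster (ends '' (↑(tᶜ) : Set ι)) u) ∧ y ∈ (openCluster (ends '' (↑(t) : Set ι)) x)) ∧ u ∉ (openCluster (ends '' (↑(t) : Set ι)) x)) ∧ u ∈ (openCluster (ends '' (↑(tᶜ) : Set ι)) x) := ⟨⟨fun h' => hyK h'.2, hu.2⟩, hu.1⟩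
        have hn1 : ¬ ((u ∈ (openCluster (ends '' (↑(tᶜ) : Set ι)) x) ∧ u ∉ (openCluster (ends '' (↑(t) : Set ι)) x)) ∧ ¬ (y ∈ (openCluster (ends '' (↑(tᶜ) : Set ι)) x) ∧ y ∈ (openCluster (ends '' (↑(t) : Set ι)) x) ∪ (openCluster (ends '' (↑(t) : Set ι)) u))) := fun h' => h'.2 ⟨hyKb, Or.inr hyUt⟩
        rw [if_pos hfire, if_neg hn1, if_pos ⟨hu, hyKb, hyUt⟩, hUe, Set.union_self, zero_add]
  · have hnf : ¬ ((¬ (y ∈ (openCluster (ends '' (↑(tᶜ) : Set ι)) x) ∪ (openCluster (ends '' (↑(tᶜ) : Set ι)) u) ∧ y ∈ (openCluster (ends '' (↑(t) : Set ι)) x)) ∧ u ∉ (openCluster (ends '' (↑(t) : Set ι)) x)) ∧ u ∈ (openCluster (ends '' (↑(tᶜ) : Set ι)) x)) := fun h' => hu ⟨h'.2, h'.1.2⟩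
    have hn1 : ¬ ((u ∈ (openCluster (ends '' (↑(tᶜ) : Set ι)) x) ∧ u ∉ (openCluster (ends '' (↑(t) : Set ι)) x)) ∧ ¬ (y ∈ (openCluster (ends '' (↑(tᶜ) : Set ι)) x) ∧ y ∈ (openCluster (ends '' (↑(t) : Set ι)) x) ∪ (openCluster (ends '' (↑(t) : Set ι)) u))) := fun h' => hu h'.1
    have hnX : ¬ ((u ∈ (openCluster (ends '' (↑(tᶜ) : Set ι)) x) ∧ u ∉ (openCluster (ends '' (↑(t) : Set ι)) x)) ∧ (y ∈ (openCluster (ends '' (↑(tᶜ) : Set ι)) x) ∧ y ∈ (openCluster (ends '' (↑(t) : Set ι)) u))) := fun h' => hu h'.1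
    rw [if_neg hnf, if_neg hn1, if_neg hnX, add_zero]

open Classical in
/-- The inner part is half the no-core sum of the same graph: the core-of-`u` colourings cancel under the swap. [cite: KozmaNitzan2024, §5.5 (context only; bookkeeping)] -/
private theorem inner_eq_half_noCore :
    2 * ∑ t : Finset ι, (if ((¬ (y ∈ (openCluster (ends '' (↑(t) : Set ι)) x) ∪ (openCluster (ends '' (↑(t) : Set ι)) u) ∧ y ∈ (openCluster (ends '' (↑(tᶜ) : Set ι)) x)) ∧ u ∉ (openCluster (ends '' (↑(tᶜ) : Set ι)) x)) ∧ u ∈ (openCluster (ends '' (↑(t) : Set ι)) x)) then (g ((openCluster (ends '' (↑(t) : Set ι)) x) ∪ (openCluster (ends '' (↑(t) : Set ι)) u)) - g (openCluster (ends '' (↑(tᶜ) : Set ι)) x)) else 0) =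
      ∑ s ∈ univ.filter (fun s : Finset ι => ¬ (y ∈ (openCluster (ends '' (↑(s) : Set ι)) x) ∧ y ∈ (openCluster (ends '' (↑(sᶜ) : Set ι)) x))),
        ((if u ∈ (openCluster (ends '' (↑(s) : Set ι)) x) then (1 : ℝ) else 0) - (if u ∈ (openCluster (ends '' (↑(sᶜ) : Set ι)) x) then (1 : ℝ) else 0)) * (g (openCluster (ends '' (↑(s) : Set ι)) x) - g (openCluster (ends '' (↑(sᶜ) : Set ι)) x)) := by
  -- the no-core sum = 2·Σ_{nc, u ∈ K} ΔG
  set R : Finset ι → ℝ := fun s => if (¬ (y ∈ (openCluster (ends '' (↑(s) : Set ι)) x) ∧ y ∈ (openCluster (ends '' (↑(sᶜ) : Set ι)) x)) ∧ u ∈ (openCluster (ends '' (↑(s) : Set ι)) x)) then (g (openCluster (ends '' (↑(s) : Set ι)) x) - g (openCluster (ends '' (↑(sᶜ) : Set ι)) x)) else 0 with hR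
  set B : Finset ι → ℝ := fun s => if (¬ (y ∈ (openCluster (ends '' (↑(s) : Set ι)) x) ∧ y ∈ (openCluster (ends '' (↑(sᶜ) : Set ι)) x)) ∧ u ∈ (openCluster (ends '' (↑(sᶜ) : Set ι)) x)) then (g (openCluster (ends '' (↑(s) : Set ι)) x) - g (openCluster (ends '' (↑(sᶜ) : Set ι)) x)) else 0 with hB
  have hNC : ∑ s ∈ univ.filter (fun s : Finset ι => ¬ (y ∈ (openCluster (ends '' (↑(s) : Set ι)) x) ∧ y ∈ (openCluster (ends '' (↑(sᶜ) : Set ι)) x))),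
      ((if u ∈ (openCluster (ends '' (↑(s) : Set ι)) x) then (1 : ℝ) else 0) - (if u ∈ (openCluster (ends '' (↑(sᶜ) : Set ι)) x) then (1 : ℝ) else 0)) * (g (openCluster (ends '' (↑(s) : Set ι)) x) - g (openCluster (ends '' (↑(sᶜ) : Set ι)) x)) = ∑ s : Finset ι, R s - ∑ s : Finset ι, B s := by
    rw [Finset.sum_filter, ← Finset.sum_sub_distrib]
    refine Finset.sum_congr rfl fun s _ => ?_
    simp only [hR, hB]
    by_cases hc : ¬ (y ∈ (openCluster (ends '' (↑(s) : Set ι)) x) ∧ y ∈ (openCluster (ends '' (↑(sᶜ) : Set ι)) x))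
    · by_cases h1 : u ∈ (openCluster (ends '' (↑(s) : Set ι)) x) <;> by_cases h2 : u ∈ (openCluster (ends '' (↑(sᶜ) : Set ι)) x)
      · rw [if_pos hc, if_pos h1, if_pos h2, if_pos ⟨hc, h1⟩, if_pos ⟨hc, h2⟩]; ring
      · have : ¬ (¬ (y ∈ (openCluster (ends '' (↑(s) : Set ι)) x) ∧ y ∈ (openCluster (ends '' (↑(sᶜ) : Set ι)) x)) ∧ u ∈ (openCluster (ends '' (↑(sᶜ) : Set ι)) x)) := fun h' => h2 h'.2
        rw [if_pos hc, if_pos h1, if_neg h2, if_pos ⟨hc, h1⟩, if_neg this]; ring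
      · have : ¬ (¬ (y ∈ (openCluster (ends '' (↑(s) : Set ι)) x) ∧ y ∈ (openCluster (ends '' (↑(sᶜ) : Set ι)) x)) ∧ u ∈ (openCluster (ends '' (↑(s) : Set ι)) x)) := fun h' => h1 h'.2
        rw [if_pos hc, if_neg h1, if_pos h2, if_neg this, if_pos ⟨hc, h2⟩]; ring
      · have e1 : ¬ (¬ (y ∈ (openCluster (ends '' (↑(s) : Set ι)) x) ∧ y ∈ (openCluster (ends '' (↑(sᶜ) : Set ι)) x)) ∧ u ∈ (openCluster (ends '' (↑(s) : Set ι)) x)) := fun h' => h1 h'.2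
        have e2 : ¬ (¬ (y ∈ (openCluster (ends '' (↑(s) : Set ι)) x) ∧ y ∈ (openCluster (ends '' (↑(sᶜ) : Set ι)) x)) ∧ u ∈ (openCluster (ends '' (↑(sᶜ) : Set ι)) x)) := fun h' => h2 h'.2
        rw [if_pos hc, if_neg h1, if_neg h2, if_neg e1, if_neg e2]; ring
    · have e1 : ¬ (¬ (y ∈ (openCluster (ends '' (↑(s) : Set ι)) x) ∧ y ∈ (openCluster (ends '' (↑(sᶜ) : Set ι)) x)) ∧ u ∈ (openCluster (ends '' (↑(s) : Set ι)) x)) := fun h' => hc h'.1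
      have e2 : ¬ (¬ (y ∈ (openCluster (ends '' (↑(s) : Set ι)) x) ∧ y ∈ (openCluster (ends '' (↑(sᶜ) : Set ι)) x)) ∧ u ∈ (openCluster (ends '' (↑(sᶜ) : Set ι)) x)) := fun h' => hc h'.1
      rw [if_neg hc, if_neg e1, if_neg e2]; ring
  have hBswap : ∑ s : Finset ι, B s = - ∑ s : Finset ι, R s := by
    rw [← sum_compl_eq (fun s : Finset ι => B s), ← Finset.sum_neg_distrib]
    refine Finset.sum_congr rfl fun s _ => ?_
    simp only [hB, hR, compl_compl]
    have hiff : (¬ (y ∈ (openCluster (ends '' (↑(sᶜ) : Set ι)) x) ∧ y ∈ (openCluster (ends '' (↑(s) : Set ι)) x)) ∧ u ∈ (openCluster (ends '' (↑(s) : Set ι)) x)) ↔ (¬ (y ∈ (openCluster (ends '' (↑(s) : Set ι)) x) ∧ y ∈ (openCluster (ends '' (↑(sᶜ) : Set ι)) x)) ∧ u ∈ (openCluster (ends '' (↑(s) : Set ι)) x)) :=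
      ⟨fun h' => ⟨fun h'' => h'.1 ⟨h''.2, h''.1⟩, h'.2⟩, fun h' => ⟨fun h'' => h'.1 ⟨h''.2, h''.1⟩, h'.2⟩⟩
    by_cases hA : (¬ (y ∈ (openCluster (ends '' (↑(s) : Set ι)) x) ∧ y ∈ (openCluster (ends '' (↑(sᶜ) : Set ι)) x)) ∧ u ∈ (openCluster (ends '' (↑(s) : Set ι)) x))
    · rw [if_pos (hiff.mpr hA), if_pos hA]; ring
    · have hA' : ¬ (¬ (y ∈ (openCluster (ends '' (↑(sᶜ) : Set ι)) x) ∧ y ∈ (openCluster (ends '' (↑(s) : Set ι)) x)) ∧ u ∈ (openCluster (ends '' (↑(s) : Set ι)) x)) := fun h' => hA (hiff.mp h')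
      rw [if_neg hA', if_neg hA]; ring
  -- remove the core-of-u colourings: their sum is swap-antisymmetric, hence zero
  set Z : Finset ι → ℝ := fun s => if ((¬ (y ∈ (openCluster (ends '' (↑(s) : Set ι)) x) ∧ y ∈ (openCluster (ends '' (↑(sᶜ) : Set ι)) x)) ∧ u ∈ (openCluster (ends '' (↑(s) : Set ι)) x)) ∧ u ∈ (openCluster (ends '' (↑(sᶜ) : Set ι)) x)) then (g (openCluster (ends '' (↑(s) : Set ι)) x) - g (openCluster (ends '' (↑(sᶜ) : Set ι)) x)) else 0 with hZ
  have hZ0 : ∑ s : Finset ι, Z s = 0 := by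
    have hneg : ∑ s : Finset ι, Z s = - ∑ s : Finset ι, Z s := by
      conv_lhs => rw [← sum_compl_eq (fun s : Finset ι => Z s)]
      rw [← Finset.sum_neg_distrib]
      refine Finset.sum_congr rfl fun s _ => ?_
      simp only [hZ, compl_compl]
      have hiff : ((¬ (y ∈ (openCluster (ends '' (↑(sᶜ) : Set ι)) x) ∧ y ∈ (openCluster (ends '' (↑(s) : Set ι)) x)) ∧ u ∈ (openCluster (ends '' (↑(sᶜ) : Set ι)) x)) ∧ u ∈ (openCluster (ends '' (↑(s) : Set ι)) x)) ↔ ((¬ (y ∈ (openCluster (ends '' (↑(s) : Set ι)) x) ∧ y ∈ (openCluster (ends '' (↑(sᶜ) : Set ι)) x)) ∧ u ∈ (openCluster (ends '' (↑(s) : Set ι)) x)) ∧ u ∈ (openCluster (ends '' (↑(sᶜ) : Set ι)) x)) :=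
        ⟨fun h' => ⟨⟨fun h'' => h'.1.1 ⟨h''.2, h''.1⟩, h'.2⟩, h'.1.2⟩, fun h' => ⟨⟨fun h'' => h'.1.1 ⟨h''.2, h''.1⟩, h'.2⟩, h'.1.2⟩⟩
      by_cases hA : ((¬ (y ∈ (openCluster (ends '' (↑(s) : Set ι)) x) ∧ y ∈ (openCluster (ends '' (↑(sᶜ) : Set ι)) x)) ∧ u ∈ (openCluster (ends '' (↑(s) : Set ι)) x)) ∧ u ∈ (openCluster (ends '' (↑(sᶜ) : Set ι)) x))
      · rw [if_pos (hiff.mpr hA), if_pos hA]; ring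
      · have hA' : ¬ ((¬ (y ∈ (openCluster (ends '' (↑(sᶜ) : Set ι)) x) ∧ y ∈ (openCluster (ends '' (↑(s) : Set ι)) x)) ∧ u ∈ (openCluster (ends '' (↑(sᶜ) : Set ι)) x)) ∧ u ∈ (openCluster (ends '' (↑(s) : Set ι)) x)) := fun h' => hA (hiff.mp h')
        rw [if_neg hA', if_neg hA]; ring
    linarith
  have hRsplit : ∑ s : Finset ι, R s =
      ∑ t : Finset ι, (if ((¬ (y ∈ (openCluster (ends '' (↑(t) : Set ι)) x) ∪ (openCluster (ends '' (↑(t) : Set ι)) u) ∧ y ∈ (openCluster (ends '' (↑(tᶜ) : Set ι)) x)) ∧ u ∉ (openCluster (ends '' (↑(tᶜ) : Set ι)) x)) ∧ u ∈ (openCluster (ends '' (↑(t) : Set ι)) x)) then (g ((openCluster (ends '' (↑(t) : Set ι)) x) ∪ (openCluster (ends '' (↑(t) : Set ι)) u)) - g (openCluster (ends '' (↑(tᶜ) : Set ι)) x)) else 0) + ∑ s : Finset ι, Z s := by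
    rw [← Finset.sum_add_distrib]
    refine Finset.sum_congr rfl fun s _ => ?_
    simp only [hR, hZ]
    by_cases hA : (¬ (y ∈ (openCluster (ends '' (↑(s) : Set ι)) x) ∧ y ∈ (openCluster (ends '' (↑(sᶜ) : Set ι)) x)) ∧ u ∈ (openCluster (ends '' (↑(s) : Set ι)) x))
    · have hUe : (openCluster (ends '' (↑(s) : Set ι)) u) = (openCluster (ends '' (↑(s) : Set ι)) x) := clusterU_eq_of_mem ends x u s hA.2
      by_cases hub : u ∈ (openCluster (ends '' (↑(sᶜ) : Set ι)) x)
      · have e1 : ¬ ((¬ (y ∈ (openCluster (ends '' (↑(s) : Set ι)) x) ∪ (openCluster (ends '' (↑(s) : Set ι)) u) ∧ y ∈ (openCluster (ends '' (↑(sᶜ) : Set ι)) x)) ∧ u ∉ (openCluster (ends '' (↑(sᶜ) : Set ι)) x)) ∧ u ∈ (openCluster (ends '' (↑(s) : Set ι)) x)) := fun h' => h'.1.2 hub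
        rw [if_pos hA, if_neg e1, if_pos ⟨hA, hub⟩, zero_add]
      · have e1 : ((¬ (y ∈ (openCluster (ends '' (↑(s) : Set ι)) x) ∪ (openCluster (ends '' (↑(s) : Set ι)) u) ∧ y ∈ (openCluster (ends '' (↑(sᶜ) : Set ι)) x)) ∧ u ∉ (openCluster (ends '' (↑(sᶜ) : Set ι)) x)) ∧ u ∈ (openCluster (ends '' (↑(s) : Set ι)) x)) := by
          refine ⟨⟨?_, hub⟩, hA.2⟩
          rw [hUe, Set.union_self]; exact hA.1
        have e2 : ¬ ((¬ (y ∈ (openCluster (ends '' (↑(s) : Set ι)) x) ∧ y ∈ (openCluster (ends '' (↑(sᶜ) : Set ι)) x)) ∧ u ∈ (openCluster (ends '' (↑(s) : Set ι)) x)) ∧ u ∈ (openCluster (ends '' (↑(sᶜ) : Set ι)) x)) := fun h' => hub h'.2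
        rw [if_pos hA, if_pos e1, if_neg e2, hUe, Set.union_self, add_zero]
    · have e1 : ¬ ((¬ (y ∈ (openCluster (ends '' (↑(s) : Set ι)) x) ∪ (openCluster (ends '' (↑(s) : Set ι)) u) ∧ y ∈ (openCluster (ends '' (↑(sᶜ) : Set ι)) x)) ∧ u ∉ (openCluster (ends '' (↑(sᶜ) : Set ι)) x)) ∧ u ∈ (openCluster (ends '' (↑(s) : Set ι)) x)) := by
        intro h'
        have hUe : (openCluster (ends '' (↑(s) : Set ι)) u) = (openCluster (ends '' (↑(s) : Set ι)) x) := clusterU_eq_of_mem ends x u s h'.2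
        apply hA
        refine ⟨?_, h'.2⟩
        have h'' := h'.1.1
        rw [hUe, Set.union_self] at h''
        exact h''
      have e2 : ¬ ((¬ (y ∈ (openCluster (ends '' (↑(s) : Set ι)) x) ∧ y ∈ (openCluster (ends '' (↑(sᶜ) : Set ι)) x)) ∧ u ∈ (openCluster (ends '' (↑(s) : Set ι)) x)) ∧ u ∈ (openCluster (ends '' (↑(sᶜ) : Set ι)) x)) := fun h' => hA h'.1
      rw [if_neg hA, if_neg e1, if_neg e2, add_zero]
  rw [hNC, hBswap, hRsplit, hZ0]
  ring

open Classical in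
/-- The walled part dominates `S_{D2}` (swap the blue term, drop the termwise-nonnegative kind `T₁₁`, swap the good mixed kind).
[cite: KozmaNitzan2024, §5.5 (context only; bookkeeping)] -/
private theorem sD2_le_walled (hg : Monotone g) :
    ∑ t : Finset ι, (if ((u ∉ (openCluster (ends '' (↑(t) : Set ι)) x) ∧ u ∉ (openCluster (ends '' (↑(tᶜ) : Set ι)) x)) ∧ (y ∈ (openCluster (ends '' (↑(t) : Set ι)) u) ∧ y ∈ (openCluster (ends '' (↑(tᶜ) : Set ι)) x))) then (g ((openCluster (ends '' (↑(tᶜ) : Set ι)) x) ∪ (openCluster (ends '' (↑(tᶜ) : Set ι)) u)) - g (openCluster (ends '' (↑(t) : Set ι)) x)) else 0) ≤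
      ∑ t : Finset ι, (if ((¬ (y ∈ (openCluster (ends '' (↑(t) : Set ι)) x) ∪ (openCluster (ends '' (↑(t) : Set ι)) u) ∧ y ∈ (openCluster (ends '' (↑(tᶜ) : Set ι)) x)) ∧ u ∉ (openCluster (ends '' (↑(tᶜ) : Set ι)) x)) ∧ u ∉ (openCluster (ends '' (↑(t) : Set ι)) x)) then (g ((openCluster (ends '' (↑(t) : Set ι)) x) ∪ (openCluster (ends '' (↑(t) : Set ι)) u)) - g (openCluster (ends '' (↑(tᶜ) : Set ι)) x)) else 0) := by
  set b : Finset ι → Prop := fun t => ¬ (y ∈ (openCluster (ends '' (↑(t) : Set ι)) x) ∪ (openCluster (ends '' (↑(t) : Set ι)) u) ∧ y ∈ (openCluster (ends '' (↑(tᶜ) : Set ι)) x)) with hb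
  have hcc : ∀ t : Finset ι, tᶜᶜ = t := fun t => compl_compl t
  change ∑ t : Finset ι, (if ((u ∉ (openCluster (ends '' (↑(t) : Set ι)) x) ∧ u ∉ (openCluster (ends '' (↑(tᶜ) : Set ι)) x)) ∧ (y ∈ (openCluster (ends '' (↑(t) : Set ι)) u) ∧ y ∈ (openCluster (ends '' (↑(tᶜ) : Set ι)) x))) then (g ((openCluster (ends '' (↑(tᶜ) : Set ι)) x) ∪ (openCluster (ends '' (↑(tᶜ) : Set ι)) u)) - g (openCluster (ends '' (↑(t) : Set ι)) x)) else 0) ≤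
    ∑ t : Finset ι, (if ((b t ∧ u ∉ (openCluster (ends '' (↑(tᶜ) : Set ι)) x)) ∧ u ∉ (openCluster (ends '' (↑(t) : Set ι)) x)) then (g ((openCluster (ends '' (↑(t) : Set ι)) x) ∪ (openCluster (ends '' (↑(t) : Set ι)) u)) - g (openCluster (ends '' (↑(tᶜ) : Set ι)) x)) else 0)
  set P : Finset ι → ℝ := fun t => if ((b t ∧ u ∉ (openCluster (ends '' (↑(tᶜ) : Set ι)) x)) ∧ u ∉ (openCluster (ends '' (↑(t) : Set ι)) x)) then g ((openCluster (ends '' (↑(t) : Set ι)) x) ∪ (openCluster (ends '' (↑(t) : Set ι)) u)) else 0 with hP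
  set Nn : Finset ι → ℝ := fun t => if ((b t ∧ u ∉ (openCluster (ends '' (↑(tᶜ) : Set ι)) x)) ∧ u ∉ (openCluster (ends '' (↑(t) : Set ι)) x)) then g (openCluster (ends '' (↑(tᶜ) : Set ι)) x) else 0 with hNn
  set Ns : Finset ι → ℝ := fun t => if ((b tᶜ ∧ u ∉ (openCluster (ends '' (↑(t) : Set ι)) x)) ∧ u ∉ (openCluster (ends '' (↑(tᶜ) : Set ι)) x)) then g (openCluster (ends '' (↑(t) : Set ι)) x) else 0 with hNs
  have hPN : ∑ t : Finset ι, (if ((b t ∧ u ∉ (openCluster (ends '' (↑(tᶜ) : Set ι)) x)) ∧ u ∉ (openCluster (ends '' (↑(t) : Set ι)) x)) then (g ((openCluster (ends '' (↑(t) : Set ι)) x) ∪ (openCluster (ends '' (↑(t) : Set ι)) u)) - g (openCluster (ends '' (↑(tᶜ) : Set ι)) x)) else 0) =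
      ∑ t : Finset ι, P t - ∑ t : Finset ι, Nn t := by
    rw [← Finset.sum_sub_distrib]
    refine Finset.sum_congr rfl fun t _ => ?_
    simp only [hP, hNn]; split_ifs <;> simp
  have hNswap : ∑ t : Finset ι, Nn t = ∑ t : Finset ι, Ns t := by
    rw [← sum_compl_eq (fun t : Finset ι => Nn t)]
    refine Finset.sum_congr rfl fun t _ => ?_
    simp only [hNn, hNs, hcc]
  set Gd : Finset ι → ℝ := fun t => if ((b t ∧ ¬ b tᶜ) ∧ (u ∉ (openCluster (ends '' (↑(t) : Set ι)) x) ∧ u ∉ (openCluster (ends '' (↑(tᶜ) : Set ι)) x))) then g ((openCluster (ends '' (↑(t) : Set ι)) x) ∪ (openCluster (ends '' (↑(t) : Set ι)) u)) else 0 with hGd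
  set Bd : Finset ι → ℝ := fun t => if ((¬ b t ∧ b tᶜ) ∧ (u ∉ (openCluster (ends '' (↑(t) : Set ι)) x) ∧ u ∉ (openCluster (ends '' (↑(tᶜ) : Set ι)) x))) then g (openCluster (ends '' (↑(t) : Set ι)) x) else 0 with hBd
  have hpt : ∀ t : Finset ι, Gd t - Bd t ≤ P t - Ns t := by
    intro t
    simp only [hGd, hBd, hP, hNs]
    have hmono : g (openCluster (ends '' (↑(t) : Set ι)) x) ≤ g ((openCluster (ends '' (↑(t) : Set ι)) x) ∪ (openCluster (ends '' (↑(t) : Set ι)) u)) := hg Set.subset_union_left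
    by_cases hw : (u ∉ (openCluster (ends '' (↑(t) : Set ι)) x) ∧ u ∉ (openCluster (ends '' (↑(tᶜ) : Set ι)) x))
    · by_cases h1 : b t
      · by_cases h2 : b tᶜ
        · have e1 : ¬ ((b t ∧ ¬ b tᶜ) ∧ (u ∉ (openCluster (ends '' (↑(t) : Set ι)) x) ∧ u ∉ (openCluster (ends '' (↑(tᶜ) : Set ι)) x))) := fun h' => h'.1.2 h2
          have e2 : ¬ ((¬ b t ∧ b tᶜ) ∧ (u ∉ (openCluster (ends '' (↑(t) : Set ι)) x) ∧ u ∉ (openCluster (ends '' (↑(tᶜ) : Set ι)) x))) := fun h' => h'.1.1 h1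
          rw [if_neg e1, if_neg e2, if_pos ⟨⟨h1, hw.2⟩, hw.1⟩, if_pos ⟨⟨h2, hw.1⟩, hw.2⟩]; linarith
        · have e2 : ¬ ((¬ b t ∧ b tᶜ) ∧ (u ∉ (openCluster (ends '' (↑(t) : Set ι)) x) ∧ u ∉ (openCluster (ends '' (↑(tᶜ) : Set ι)) x))) := fun h' => h'.1.1 h1
          have e3 : ¬ ((b tᶜ ∧ u ∉ (openCluster (ends '' (↑(t) : Set ι)) x)) ∧ u ∉ (openCluster (ends '' (↑(tᶜ) : Set ι)) x)) := fun h' => h2 h'.1.1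
          rw [if_pos ⟨⟨h1, h2⟩, hw⟩, if_neg e2, if_pos ⟨⟨h1, hw.2⟩, hw.1⟩, if_neg e3]
      · by_cases h2 : b tᶜ
        · have e1 : ¬ ((b t ∧ ¬ b tᶜ) ∧ (u ∉ (openCluster (ends '' (↑(t) : Set ι)) x) ∧ u ∉ (openCluster (ends '' (↑(tᶜ) : Set ι)) x))) := fun h' => h1 h'.1.1
          have e3 : ¬ ((b t ∧ u ∉ (openCluster (ends '' (↑(tᶜ) : Set ι)) x)) ∧ u ∉ (openCluster (ends '' (↑(t) : Set ι)) x)) := fun h' => h1 h'.1.1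
          rw [if_neg e1, if_pos ⟨⟨h1, h2⟩, hw⟩, if_neg e3, if_pos ⟨⟨h2, hw.1⟩, hw.2⟩]
        · have e1 : ¬ ((b t ∧ ¬ b tᶜ) ∧ (u ∉ (openCluster (ends '' (↑(t) : Set ι)) x) ∧ u ∉ (openCluster (ends '' (↑(tᶜ) : Set ι)) x))) := fun h' => h1 h'.1.1
          have e2 : ¬ ((¬ b t ∧ b tᶜ) ∧ (u ∉ (openCluster (ends '' (↑(t) : Set ι)) x) ∧ u ∉ (openCluster (ends '' (↑(tᶜ) : Set ι)) x))) := fun h' => h2 h'.1.2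
          have e3 : ¬ ((b t ∧ u ∉ (openCluster (ends '' (↑(tᶜ) : Set ι)) x)) ∧ u ∉ (openCluster (ends '' (↑(t) : Set ι)) x)) := fun h' => h1 h'.1.1
          have e4 : ¬ ((b tᶜ ∧ u ∉ (openCluster (ends '' (↑(t) : Set ι)) x)) ∧ u ∉ (openCluster (ends '' (↑(tᶜ) : Set ι)) x)) := fun h' => h2 h'.1.1
          rw [if_neg e1, if_neg e2, if_neg e3, if_neg e4]
    · have e1 : ¬ ((b t ∧ ¬ b tᶜ) ∧ (u ∉ (openCluster (ends '' (↑(t) : Set ι)) x) ∧ u ∉ (openCluster (ends '' (↑(tᶜ) : Set ι)) x))) := fun h' => hw h'.2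
      have e2 : ¬ ((¬ b t ∧ b tᶜ) ∧ (u ∉ (openCluster (ends '' (↑(t) : Set ι)) x) ∧ u ∉ (openCluster (ends '' (↑(tᶜ) : Set ι)) x))) := fun h' => hw h'.2
      have e3 : ¬ ((b t ∧ u ∉ (openCluster (ends '' (↑(tᶜ) : Set ι)) x)) ∧ u ∉ (openCluster (ends '' (↑(t) : Set ι)) x)) := fun h' => hw ⟨h'.2, h'.1.2⟩
      have e4 : ¬ ((b tᶜ ∧ u ∉ (openCluster (ends '' (↑(t) : Set ι)) x)) ∧ u ∉ (openCluster (ends '' (↑(tᶜ) : Set ι)) x)) := fun h' => hw ⟨h'.1.2, h'.2⟩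
      rw [if_neg e1, if_neg e2, if_neg e3, if_neg e4]
  have hGswap : ∑ t : Finset ι, Gd t = ∑ t : Finset ι, (if ((¬ b t ∧ b tᶜ) ∧ (u ∉ (openCluster (ends '' (↑(t) : Set ι)) x) ∧ u ∉ (openCluster (ends '' (↑(tᶜ) : Set ι)) x))) then g ((openCluster (ends '' (↑(tᶜ) : Set ι)) x) ∪ (openCluster (ends '' (↑(tᶜ) : Set ι)) u)) else 0) := by
    rw [← sum_compl_eq (fun t : Finset ι => Gd t)]
    refine Finset.sum_congr rfl fun t _ => ?_
    simp only [hGd, hcc]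
    have hiff : ((b tᶜ ∧ ¬ b t) ∧ (u ∉ (openCluster (ends '' (↑(tᶜ) : Set ι)) x) ∧ u ∉ (openCluster (ends '' (↑(t) : Set ι)) x))) ↔ ((¬ b t ∧ b tᶜ) ∧ (u ∉ (openCluster (ends '' (↑(t) : Set ι)) x) ∧ u ∉ (openCluster (ends '' (↑(tᶜ) : Set ι)) x))) :=
      ⟨fun h' => ⟨⟨h'.1.2, h'.1.1⟩, h'.2.2, h'.2.1⟩, fun h' => ⟨⟨h'.1.2, h'.1.1⟩, h'.2.2, h'.2.1⟩⟩
    by_cases hA : ((¬ b t ∧ b tᶜ) ∧ (u ∉ (openCluster (ends '' (↑(t) : Set ι)) x) ∧ u ∉ (openCluster (ends '' (↑(tᶜ) : Set ι)) x)))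
    · rw [if_pos (hiff.mpr hA), if_pos hA]
    · have hA' : ¬ ((b tᶜ ∧ ¬ b t) ∧ (u ∉ (openCluster (ends '' (↑(tᶜ) : Set ι)) x) ∧ u ∉ (openCluster (ends '' (↑(t) : Set ι)) x))) := fun h' => hA (hiff.mp h')
      rw [if_neg hA', if_neg hA]
  have hbad : ∀ t : Finset ι, ((¬ b t ∧ b tᶜ) ∧ (u ∉ (openCluster (ends '' (↑(t) : Set ι)) x) ∧ u ∉ (openCluster (ends '' (↑(tᶜ) : Set ι)) x))) ↔ ((u ∉ (openCluster (ends '' (↑(t) : Set ι)) x) ∧ u ∉ (openCluster (ends '' (↑(tᶜ) : Set ι)) x)) ∧ (y ∈ (openCluster (ends '' (↑(t) : Set ι)) u) ∧ y ∈ (openCluster (ends '' (↑(tᶜ) : Set ι)) x))) := by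
    intro t
    simp only [hb, not_not, hcc]
    constructor
    · rintro ⟨⟨⟨hyKU, hyKb⟩, hbc⟩, hw⟩
      refine ⟨hw, ?_, hyKb⟩
      rcases hyKU with hyK | hyUt
      · exact absurd ⟨Or.inl hyKb, hyK⟩ hbc
      · exact hyUt
    · rintro ⟨hw, hyUt, hyKb⟩
      exact ⟨⟨⟨Or.inr hyUt, hyKb⟩, fun h' => (not_mem_K_of_mem_U ends x u y t hw.1 hyUt) h'.2⟩, hw⟩
  have hSD2eq : ∑ t : Finset ι, (if ((u ∉ (openCluster (ends '' (↑(t) : Set ι)) x) ∧ u ∉ (openCluster (ends '' (↑(tᶜ) : Set ι)) x)) ∧ (y ∈ (openCluster (ends '' (↑(t) : Set ι)) u) ∧ y ∈ (openCluster (ends '' (↑(tᶜ) : Set ι)) x))) then (g ((openCluster (ends '' (↑(tᶜ) : Set ι)) x) ∪ (openCluster (ends '' (↑(tᶜ) : Set ι)) u)) - g (openCluster (ends '' (↑(t) : Set ι)) x)) else 0) =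
      ∑ t : Finset ι, Gd t - ∑ t : Finset ι, Bd t := by
    rw [hGswap, ← Finset.sum_sub_distrib]
    refine Finset.sum_congr rfl fun t _ => ?_
    simp only [hBd]
    by_cases h : ((¬ b t ∧ b tᶜ) ∧ (u ∉ (openCluster (ends '' (↑(t) : Set ι)) x) ∧ u ∉ (openCluster (ends '' (↑(tᶜ) : Set ι)) x)))
    · rw [if_pos h, if_pos h, if_pos ((hbad t).mp h)]
    · have h' : ¬ ((u ∉ (openCluster (ends '' (↑(t) : Set ι)) x) ∧ u ∉ (openCluster (ends '' (↑(tᶜ) : Set ι)) x)) ∧ (y ∈ (openCluster (ends '' (↑(t) : Set ι)) u) ∧ y ∈ (openCluster (ends '' (↑(tᶜ) : Set ι)) x))) := fun h'' => h ((hbad t).mpr h'')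
      rw [if_neg h, if_neg h, if_neg h', sub_zero]
  rw [hPN, hNswap, hSD2eq, ← Finset.sum_sub_distrib, ← Finset.sum_sub_distrib]
  exact Finset.sum_le_sum fun t _ => hpt t

open Classical in
/-- LEMMA S′'s sum splits as `S_{D2} + X` (at `u ∈ K̄`, `Ū = K̄`). [cite: KozmaNitzan2024, §5.5 (context only; bookkeeping)] -/
private theorem lemmaS'_split :
    ∑ s ∈ univ.filter (fun s : Finset ι => x ∉ (openCluster (ends '' (↑(s) : Set ι)) u) ∧ y ∈ (openCluster (ends '' (↑(s) : Set ι)) u) ∧ y ∈ (openCluster (ends '' (↑(sᶜ) : Set ι)) x)), (g ((openCluster (ends '' (↑(sᶜ) : Set ι)) x) ∪ (openCluster (ends '' (↑(sᶜ) : Set ι)) u)) - g (openCluster (ends '' (↑(s) : Set ι)) x)) =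
      ∑ t : Finset ι, ((if ((u ∉ (openCluster (ends '' (↑(t) : Set ι)) x) ∧ u ∉ (openCluster (ends '' (↑(tᶜ) : Set ι)) x)) ∧ (y ∈ (openCluster (ends '' (↑(t) : Set ι)) u) ∧ y ∈ (openCluster (ends '' (↑(tᶜ) : Set ι)) x))) then (g ((openCluster (ends '' (↑(tᶜ) : Set ι)) x) ∪ (openCluster (ends '' (↑(tᶜ) : Set ι)) u)) - g (openCluster (ends '' (↑(t) : Set ι)) x)) else 0) +
        (if ((u ∈ (openCluster (ends '' (↑(tᶜ) : Set ι)) x) ∧ u ∉ (openCluster (ends '' (↑(t) : Set ι)) x)) ∧ (y ∈ (openCluster (ends '' (↑(tᶜ) : Set ι)) x) ∧ y ∈ (openCluster (ends '' (↑(t) : Set ι)) u))) then (g (openCluster (ends '' (↑(tᶜ) : Set ι)) x) - g (openCluster (ends '' (↑(t) : Set ι)) x)) else 0)) := by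
  have hxU : ∀ t : Finset ι, x ∉ (openCluster (ends '' (↑(t) : Set ι)) u) ↔ u ∉ (openCluster (ends '' (↑(t) : Set ι)) x) := fun t =>
    not_congr ⟨fun h => SimpleGraph.Reachable.symm h, fun h => SimpleGraph.Reachable.symm h⟩
  rw [Finset.sum_filter]
  refine Finset.sum_congr rfl fun t _ => ?_
  by_cases h : (x ∉ (openCluster (ends '' (↑(t) : Set ι)) u) ∧ y ∈ (openCluster (ends '' (↑(t) : Set ι)) u) ∧ y ∈ (openCluster (ends '' (↑(tᶜ) : Set ι)) x))
  · have huK : u ∉ (openCluster (ends '' (↑(t) : Set ι)) x) := (hxU t).mp h.1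
    rw [if_pos h]
    by_cases hub : u ∈ (openCluster (ends '' (↑(tᶜ) : Set ι)) x)
    · have hUe : (openCluster (ends '' (↑(tᶜ) : Set ι)) u) = (openCluster (ends '' (↑(tᶜ) : Set ι)) x) := clusterU_eq_of_mem ends x u tᶜ hub
      have e1 : ¬ ((u ∉ (openCluster (ends '' (↑(t) : Set ι)) x) ∧ u ∉ (openCluster (ends '' (↑(tᶜ) : Set ι)) x)) ∧ (y ∈ (openCluster (ends '' (↑(t) : Set ι)) u) ∧ y ∈ (openCluster (ends '' (↑(tᶜ) : Set ι)) x))) := fun h' => h'.1.2 hub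
      rw [if_neg e1, if_pos ⟨⟨hub, huK⟩, h.2.2, h.2.1⟩, hUe, Set.union_self, zero_add]
    · have e2 : ¬ ((u ∈ (openCluster (ends '' (↑(tᶜ) : Set ι)) x) ∧ u ∉ (openCluster (ends '' (↑(t) : Set ι)) x)) ∧ (y ∈ (openCluster (ends '' (↑(tᶜ) : Set ι)) x) ∧ y ∈ (openCluster (ends '' (↑(t) : Set ι)) u))) := fun h' => hub h'.1.1
      rw [if_pos ⟨⟨huK, hub⟩, h.2.1, h.2.2⟩, if_neg e2, add_zero]
  · have e1 : ¬ ((u ∉ (openCluster (ends '' (↑(t) : Set ι)) x) ∧ u ∉ (openCluster (ends '' (↑(tᶜ) : Set ι)) x)) ∧ (y ∈ (openCluster (ends '' (↑(t) : Set ι)) u) ∧ y ∈ (openCluster (ends '' (↑(tᶜ) : Set ι)) x))) := fun h' => h ⟨(hxU t).mpr h'.1.1, h'.2.1, h'.2.2⟩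
    have e2 : ¬ ((u ∈ (openCluster (ends '' (↑(tᶜ) : Set ι)) x) ∧ u ∉ (openCluster (ends '' (↑(t) : Set ι)) x)) ∧ (y ∈ (openCluster (ends '' (↑(tᶜ) : Set ι)) x) ∧ y ∈ (openCluster (ends '' (↑(t) : Set ι)) u))) := fun h' => h ⟨(hxU t).mpr h'.1.2, h'.2.2, h'.2.1⟩
    rw [if_neg h, if_neg e1, if_neg e2, add_zero]

open Classical in
/-- **Root-edge anatomy I (prim-lf-2 gen 53, memo §7.4).**  On any finite multigraph with root `x`, for vertices `u, y` and a monotone `g` (`K = C_x`, `U = C_u`, bars = complement colouring):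
`Σ_{t : u ∈ K̄t ∖ Kt, ¬(y ∈ K̄t ∧ y ∈ Kt ∪ Ut)} (g(K̄t) − g(Kt)) ≤ Σ_{t : ¬(y ∈ Kt ∪ Ut ∧ y ∈ K̄t), u ∉ K̄t} (g(Kt ∪ Ut) − g(K̄t))`, i.e. `S′_{D1} ≤ ½·NO-CORE^G` for a root-adjacent
point (the right side is part 3's half no-core sum).  Uses LEMMA S′ (part 5).  [cite: KozmaNitzan2024, Questions 8–9 (§5.5 p. 36) (context)] -/
theorem rootEdge_half_ge_sprimeD1 (hg : Monotone g) :
    ∑ t ∈ univ.filter (fun t : Finset ι => (u ∈ (openCluster (ends '' (↑(tᶜ) : Set ι)) x) ∧ u ∉ (openCluster (ends '' (↑(t) : Set ι)) x)) ∧ ¬ (y ∈ (openCluster (ends '' (↑(tᶜ) : Set ι)) x) ∧ y ∈ (openCluster (ends '' (↑(t) : Set ι)) x) ∪ (openCluster (ends '' (↑(t) : Set ι)) u))), (g (openCluster (ends '' (↑(tᶜ) : Set ι)) x) - g (openCluster (ends '' (↑(t) : Set ι)) x)) ≤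
    ∑ t ∈ univ.filter (fun t : Finset ι => ¬ (y ∈ (openCluster (ends '' (↑(t) : Set ι)) x) ∪ (openCluster (ends '' (↑(t) : Set ι)) u) ∧ y ∈ (openCluster (ends '' (↑(tᶜ) : Set ι)) x)) ∧ u ∉ (openCluster (ends '' (↑(tᶜ) : Set ι)) x)), (g ((openCluster (ends '' (↑(t) : Set ι)) x) ∪ (openCluster (ends '' (↑(t) : Set ι)) u)) - g (openCluster (ends '' (↑(tᶜ) : Set ι)) x)) := by
  have hL : ∑ t ∈ univ.filter (fun t : Finset ι => (u ∈ (openCluster (ends '' (↑(tᶜ) : Set ι)) x) ∧ u ∉ (openCluster (ends '' (↑(t) : Set ι)) x)) ∧ ¬ (y ∈ (openCluster (ends '' (↑(tᶜ) : Set ι)) x) ∧ y ∈ (openCluster (ends '' (↑(t) : Set ι)) x) ∪ (openCluster (ends '' (↑(t) : Set ι)) u))), (g (openCluster (ends '' (↑(tᶜ) : Set ι)) x) - g (openCluster (ends '' (↑(t) : Set ι)) x)) =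
      ∑ t : Finset ι, (if ((u ∈ (openCluster (ends '' (↑(tᶜ) : Set ι)) x) ∧ u ∉ (openCluster (ends '' (↑(t) : Set ι)) x)) ∧ ¬ (y ∈ (openCluster (ends '' (↑(tᶜ) : Set ι)) x) ∧ y ∈ (openCluster (ends '' (↑(t) : Set ι)) x) ∪ (openCluster (ends '' (↑(t) : Set ι)) u))) then (g (openCluster (ends '' (↑(tᶜ) : Set ι)) x) - g (openCluster (ends '' (↑(t) : Set ι)) x)) else 0) := by
    rw [Finset.sum_filter]
  have hS' := flipHarris_twoSided_nonneg ends x u y g hg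
  rw [lemmaS'_split ends x u y g, Finset.sum_add_distrib] at hS'
  have h1 := half_split ends x u y g
  have h2 := inner_swap_eq ends x u y g
  rw [Finset.sum_add_distrib] at h2
  have h3 := sD2_le_walled ends x u y g hg
  rw [hL, h1, h2]
  linarith

open Classical in
/-- **Root-edge anatomy II (prim-lf-2 gen 53, memo §7.4).**  On any finite multigraph with root `x`, for vertices `u, y` and a monotone `g`:
`NO-CORE(y)[1_u,g] + 2·S_{D2} ≤ 2·Σ_{t : ¬(y ∈ Kt ∪ Ut ∧ y ∈ K̄t), u ∉ K̄t} (g(Kt ∪ Ut) − g(K̄t))` with `S_{D2} := Σ_{t : u ∉ Kt ∪ K̄t, y ∈ Ut ∩ K̄t} (g(K̄t ∪ Ūt) − g(Kt))`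
(the no-core sum of the SAME graph on the left; for `G − e` the right side is `NO-CORE^G`, part 3).  [cite: KozmaNitzan2024, Questions 8–9 (§5.5 p. 36) (context)] -/
theorem rootEdge_half_ge_halfNoCore_add_sD2 (hg : Monotone g) :
    ∑ s ∈ univ.filter (fun s : Finset ι => ¬ (y ∈ (openCluster (ends '' (↑(s) : Set ι)) x) ∧ y ∈ (openCluster (ends '' (↑(sᶜ) : Set ι)) x))), ((if u ∈ (openCluster (ends '' (↑(s) : Set ι)) x) then (1 : ℝ) else 0) - (if u ∈ (openCluster (ends '' (↑(sᶜ) : Set ι)) x) then (1 : ℝ) else 0)) * (g (openCluster (ends '' (↑(s) : Set ι)) x) - g (openCluster (ends '' (↑(sᶜ) : Set ι)) x)) +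
    2 * ∑ t ∈ univ.filter (fun t : Finset ι => (u ∉ (openCluster (ends '' (↑(t) : Set ι)) x) ∧ u ∉ (openCluster (ends '' (↑(tᶜ) : Set ι)) x)) ∧ (y ∈ (openCluster (ends '' (↑(t) : Set ι)) u) ∧ y ∈ (openCluster (ends '' (↑(tᶜ) : Set ι)) x))), (g ((openCluster (ends '' (↑(tᶜ) : Set ι)) x) ∪ (openCluster (ends '' (↑(tᶜ) : Set ι)) u)) - g (openCluster (ends '' (↑(t) : Set ι)) x)) ≤
    2 * ∑ t ∈ univ.filter (fun t : Finset ι => ¬ (y ∈ (openCluster (ends '' (↑(t) : Set ι)) x) ∪ (openCluster (ends '' (↑(t) : Set ι)) u) ∧ y ∈ (openCluster (ends '' (↑(tᶜ) : Set ι)) x)) ∧ u ∉ (openCluster (ends '' (↑(tᶜ) : Set ι)) x)), (g ((openCluster (ends '' (↑(t) : Set ι)) x) ∪ (openCluster (ends '' (↑(t) : Set ι)) u)) - g (openCluster (ends '' (↑(tᶜ) : Set ι)) x)) := by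
  have hD : ∑ t ∈ univ.filter (fun t : Finset ι => (u ∉ (openCluster (ends '' (↑(t) : Set ι)) x) ∧ u ∉ (openCluster (ends '' (↑(tᶜ) : Set ι)) x)) ∧ (y ∈ (openCluster (ends '' (↑(t) : Set ι)) u) ∧ y ∈ (openCluster (ends '' (↑(tᶜ) : Set ι)) x))), (g ((openCluster (ends '' (↑(tᶜ) : Set ι)) x) ∪ (openCluster (ends '' (↑(tᶜ) : Set ι)) u)) - g (openCluster (ends '' (↑(t) : Set ι)) x)) =
      ∑ t : Finset ι, (if ((u ∉ (openCluster (ends '' (↑(t) : Set ι)) x) ∧ u ∉ (openCluster (ends '' (↑(tᶜ) : Set ι)) x)) ∧ (y ∈ (openCluster (ends '' (↑(t) : Set ι)) u) ∧ y ∈ (openCluster (ends '' (↑(tᶜ) : Set ι)) x))) then (g ((openCluster (ends '' (↑(tᶜ) : Set ι)) x) ∪ (openCluster (ends '' (↑(tᶜ) : Set ι)) u)) - g (openCluster (ends '' (↑(t) : Set ι)) x)) else 0) := by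
    rw [Finset.sum_filter]
  have h1 := half_split ends x u y g
  have h2 := inner_eq_half_noCore ends x u y g
  have h3 := sD2_le_walled ends x u y g hg
  rw [hD, h1, ← h2]
  linarith

end anatomy

end Coefficientwise

end Summit.CriticalPhenomena.PercolationContinuityZ3.Theorems
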